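import Literature.MathematicalPhysics.QuantumLattice.HubbardUmklappKinematics
import Literature.MathematicalPhysics.QuantumLattice.HubbardFermiBandCurvature
import Literature.MathematicalPhysics.QuantumLattice.HubbardFermiPolar
import HarnessLib

/-!
# Umklapp quadruples on the band Fermi curve degenerate only at folds

Topic `Literature/MathematicalPhysics/QuantumLattice`; joins `HubbardUmklappKinematics.lean`
(Cooper-disjointness of umklapp quadruples on `{ε = μ}`, `-4 < μ < 0`) with the whole-band polar
parametrisation `fermiPolar μ θ = u_μ(θ) (cos θ, sin θ)` and its Gauss map
(`HubbardFermiRadiusBand*.lean`, `HubbardFermiPolar.lean`, `HubbardFermiBandCurvature.lean`: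
`exists_eq_add_int_mul_pi_of_cross_eq_zero` — parallel gradients only at `θ + jπ`).

In the sector-counting lemmas of Benfatto–Giuliani–Mastropietro (Ann. Henri Poincaré 7 (2006),
Lemma 3.1 / App. A2 and Lemma A3.1) the pair `(k₃, k₄)` completing a quartic vertex is found by
Dini's theorem, whose Jacobian degenerates exactly when the tangents (equivalently the gradients
`∇ε/2 = (sin k₁, sin k₂)`) at `k₃` and `k₄` are parallel. On a centrally symmetric strictly convex
curve this means `k₄ = ± k₃` (`fermiPolar_eq_or_eq_neg_of_cross_eq_zero`): the Cooper configuration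
`k₄ = -k₃` or the fold `k₄ = k₃`. For momentum conservation MODULO a non-zero reciprocal vector
the Cooper configuration is excluded by `umklapp_cooper_disjoint`, so **an umklapp quadruple with
two parallel legs has those two legs EQUAL** (`fermiPolar_eq_of_umklapp_of_cross_eq_zero`): only fold
degeneracies occur.

* `fermiPolar_add_int_mul_pi` — `p(θ + jπ) = ± p(θ)` (from the central symmetry
  `fermiPolar_add_pi` of `HubbardFermiPolar.lean`);
* `cross_sin_eq_mul_cross_velocity` — gradient cross product `=` (positive factor) `×` tangent
  cross product, so "parallel gradients" and "parallel tangents" agree;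
* `fermiPolar_eq_or_eq_neg_of_cross_eq_zero` — parallel gradients force `k' = ± k`;
* `fermiPolar_eq_of_umklapp_of_cross_eq_zero` — in an umklapp quadruple, `k' = k`;
* (§ Convexity) the uniform strict-convexity constant of the level curves, explicit in `μ`:
  `cos a sin² b + cos b sin² a = m (1 - cos a cos b) ≥ m (1 - m²/4)` on `cos a + cos b = m`
  (`level_curvature_numerator_ge`), and for the band curve
  `c² (cos x · x'² + cos y · y'²) ≥ (-μ/2)(1 - μ²/16) > 0` (`bandNormalCoeff_sq_mul_bandHess_ge`) —
  the constant behind `bandHess_pos`, degenerating only as `μ → 0⁻` (flat diamond) or `μ → -4⁺`.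

Everything is PROVED; no definitions. [folklore]

## Sources

G. Benfatto, A. Giuliani, V. Mastropietro, Ann. Henri Poincaré 7 (2006) 809–898, App. A2 (A2.10)
(the Jacobian `∝ sin(α(θ₁) - α(θ₂))`) and Lemma A3.1 (`BenfattoGiulianiMastropietro2006`).
-/

noncomputable section

open Real Finset

namespace Literature.MathematicalPhysics.QuantumLattice

section Band

variable {μ : ℝ} (hμ₁ : -4 < μ) (hμ₂ : μ < 0)
include hμ₁ hμ₂

/-- `p(θ + jπ) = p(θ)` for even `j` and `= -p(θ)` for odd `j`. [folklore] -/
theorem fermiPolar_add_int_mul_pi (θ : ℝ) (j : ℤ) :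
    fermiPolar μ (θ + j * π) = fermiPolar μ θ ∨ fermiPolar μ (θ + j * π) = -fermiPolar μ θ := by
  rcases Int.even_or_odd' j with ⟨l, rfl | rfl⟩
  · left
    have := fermiPolar_add_int_mul_two_pi hμ₁ hμ₂ θ l
    push_cast at this ⊢
    rwa [show θ + 2 * (l : ℝ) * π = θ + l * (2 * π) by ring]
  · right
    have h1 := fermiPolar_add_int_mul_two_pi hμ₁ hμ₂ (θ + π) l
    rw [fermiPolar_add_pi hμ₁ hμ₂ θ] at h1
    push_cast
    rwa [show θ + (2 * (l : ℝ) + 1) * π = θ + π + l * (2 * π) by ring]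

/-- **Gradient cross product versus tangent cross product**: with `(sin x, sin y) = c (y', -x')`,
`c = bandNormalCoeff > 0`, one has
`sin x(θ) sin y(φ) - sin y(θ) sin x(φ) = c(θ) c(φ) (x'(θ) y'(φ) - y'(θ) x'(φ))`; in particular the
gradients at `θ, φ` are parallel iff the tangents are. [folklore] -/
theorem cross_sin_eq_mul_cross_velocity (θ φ : ℝ) :
    Real.sin (bandX μ θ) * Real.sin (bandY μ φ) - Real.sin (bandY μ θ) * Real.sin (bandX μ φ) =
      bandNormalCoeff μ θ * bandNormalCoeff μ φ *
        (bandVX μ θ * bandVY μ φ - bandVY μ θ * bandVX μ φ) := by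
  rw [sin_bandX_eq hμ₁ hμ₂ θ, sin_bandY_eq hμ₁ hμ₂ θ, sin_bandX_eq hμ₁ hμ₂ φ, sin_bandY_eq hμ₁ hμ₂ φ]
  ring

/-- Parallel tangents iff parallel gradients. [folklore] -/
theorem cross_velocity_eq_zero_iff (θ φ : ℝ) :
    bandVX μ θ * bandVY μ φ - bandVY μ θ * bandVX μ φ = 0 ↔
      Real.sin (bandX μ θ) * Real.sin (bandY μ φ) - Real.sin (bandY μ θ) * Real.sin (bandX μ φ) = 0 := by
  rw [cross_sin_eq_mul_cross_velocity hμ₁ hμ₂]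
  have hc := mul_pos (bandNormalCoeff_pos hμ₁ hμ₂ θ) (bandNormalCoeff_pos hμ₁ hμ₂ φ)
  constructor
  · intro h; rw [h, mul_zero]
  · intro h
    rcases mul_eq_zero.1 h with h0 | h0
    · exact absurd h0 hc.ne'
    · exact h0

/-- **Parallel gradients force `k' = ± k`** on the band Fermi curve (central symmetry + injective
Gauss map): the fold `k' = k` or the Cooper configuration `k' = -k`. [folklore] -/
theorem fermiPolar_eq_or_eq_neg_of_cross_eq_zero {θ φ : ℝ}
    (h : Real.sin (bandX μ θ) * Real.sin (bandY μ φ) - Real.sin (bandY μ θ) * Real.sin (bandX μ φ) = 0) :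
    fermiPolar μ φ = fermiPolar μ θ ∨ fermiPolar μ φ = -fermiPolar μ θ := by
  obtain ⟨j, rfl⟩ := exists_eq_add_int_mul_pi_of_cross_eq_zero hμ₁ hμ₂ h
  exact fermiPolar_add_int_mul_pi hμ₁ hμ₂ θ j

/-- **In an umklapp quadruple two legs with parallel gradients are equal (a fold).** Four points
`p(θⱼ)` of the band Fermi curve with `Σⱼ p(θⱼ) = 2π n`, `n ≠ 0`: if the gradients at legs
`j ≠ j'` are parallel then `p(θⱼ') = p(θⱼ)` — the alternative `p(θⱼ') = -p(θⱼ)` would be a Cooper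
pair, excluded by `umklapp_cooper_disjoint`. (So for a non-zero reciprocal vector the Dini Jacobian
of BGM 2006 App. A2 drops rank only on folds.) [folklore] -/
theorem fermiPolar_eq_of_umklapp_of_cross_eq_zero (θ : Fin 4 → ℝ) {n : Fin 2 → ℤ} (hn : n ≠ 0)
    (hsum : ∀ i, ∑ j, fermiPolar μ (θ j) i = 2 * π * n i) {j j' : Fin 4} (hjj : j ≠ j')
    (h : Real.sin (bandX μ (θ j)) * Real.sin (bandY μ (θ j')) -
      Real.sin (bandY μ (θ j)) * Real.sin (bandX μ (θ j')) = 0) :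
    fermiPolar μ (θ j') = fermiPolar μ (θ j) := by
  rcases fermiPolar_eq_or_eq_neg_of_cross_eq_zero hμ₁ hμ₂ h with he | he
  · exact he
  · exfalso
    -- the quadruple as momenta in the fundamental domain
    have hk : ∀ (l : Fin 4) (i : Fin 2), |fermiPolar μ (θ l) i| ≤ π :=
      fun l i => (abs_fermiPolar_apply_lt hμ₁ hμ₂ (θ l) i).le
    have he' : ∀ l : Fin 4, sqDispersion (fun i => fermiPolar μ (θ l) i) = μ := fun l => by
      have h1 := sqDispersion_ofLp_fermiPolar hμ₁ hμ₂ (θ l)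
      have h2 : (fun i => fermiPolar μ (θ l) i) = WithLp.ofLp (fermiPolar μ (θ l)) := by
        ext i; fin_cases i <;> simp
      rw [h2]; exact h1
    obtain ⟨i, hi⟩ := umklapp_cooper_disjoint (k := fun l i => fermiPolar μ (θ l) i) hk he' hn hsum hjj
    have hzero : fermiPolar μ (θ j) i + fermiPolar μ (θ j') i = 0 := by
      rw [he]; simp
    have hgap := umklapp_cooper_gap_pos hμ₂
    simp only [hzero, abs_zero] at hi
    linarith

end Band

/-! ### Uniform strict convexity constant of the level curves (card (G1), explicit in `μ`) -/

section Convexity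

/-- **The curvature numerator on a level curve**: if `cos a + cos b = m` then
`cos a · sin² b + cos b · sin² a = m (1 - cos a cos b)`. [folklore] -/
theorem cos_mul_sin_sq_add_eq {a b m : ℝ} (h : Real.cos a + Real.cos b = m) :
    Real.cos a * Real.sin b ^ 2 + Real.cos b * Real.sin a ^ 2 = m * (1 - Real.cos a * Real.cos b) := by
  have ha : Real.sin a ^ 2 = 1 - Real.cos a ^ 2 := by rw [Real.sin_sq]
  have hb : Real.sin b ^ 2 = 1 - Real.cos b ^ 2 := by rw [Real.sin_sq]
  rw [← h, ha, hb]; ring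

/-- **Uniform lower bound** `m (1 - m²/4) ≤ cos a · sin² b + cos b · sin² a` on the level curve
`cos a + cos b = m`, `m ≥ 0` (AM–GM: `cos a cos b ≤ m²/4`). For `m = -μ/2 ∈ (0, 2)`, i.e.
`-4 < μ < 0`, the constant `m (1 - m²/4)` is positive and degenerates only at the band bottom
(`m → 2`) and at half filling (`m → 0`, the flat diamond). [folklore] -/
theorem level_curvature_numerator_ge {a b m : ℝ} (h : Real.cos a + Real.cos b = m) (hm : 0 ≤ m) :
    m * (1 - m ^ 2 / 4) ≤ Real.cos a * Real.sin b ^ 2 + Real.cos b * Real.sin a ^ 2 := by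
  rw [cos_mul_sin_sq_add_eq h]
  have hamgm : Real.cos a * Real.cos b ≤ m ^ 2 / 4 := by
    nlinarith [sq_nonneg (Real.cos a - Real.cos b)]
  nlinarith

/-- The constant is positive throughout the band: `0 < m (1 - m²/4)` for `0 < m < 2`. [folklore] -/
theorem level_curvature_constant_pos {m : ℝ} (hm0 : 0 < m) (hm2 : m < 2) : 0 < m * (1 - m ^ 2 / 4) := by
  apply mul_pos hm0
  nlinarith

/-- On `{ε = μ}` (`sqDispersion k = μ`): `(-μ/2)(1 - μ²/16) ≤ cos k₁ sin² k₂ + cos k₂ sin² k₁`. [folklore] -/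
theorem level_curvature_numerator_ge_of_sqDispersion_eq {μ : ℝ} (hμ : μ ≤ 0) {k : Fin 2 → ℝ}
    (he : sqDispersion k = μ) :
    (-μ / 2) * (1 - μ ^ 2 / 16) ≤
      Real.cos (k 0) * Real.sin (k 1) ^ 2 + Real.cos (k 1) * Real.sin (k 0) ^ 2 := by
  have h : Real.cos (k 0) + Real.cos (k 1) = -μ / 2 := by unfold sqDispersion at he; linarith
  have := level_curvature_numerator_ge h (by linarith)
  convert this using 1; ring

variable {μ : ℝ} (hμ₁ : -4 < μ) (hμ₂ : μ < 0)
include hμ₁ hμ₂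

/-- **Explicit strict convexity of the band Fermi curve**: with `c = bandNormalCoeff μ θ > 0`,
`c² (cos x · x'² + cos y · y'²) = cos x sin² y + cos y sin² x ≥ (-μ/2)(1 - μ²/16) > 0`
(the qualitative `bandHess_pos` of `HubbardFermiBandCurvature.lean` with its constant). [folklore] -/
theorem bandNormalCoeff_sq_mul_bandHess_ge (θ : ℝ) :
    (-μ / 2) * (1 - μ ^ 2 / 16) ≤
      bandNormalCoeff μ θ ^ 2 * (Real.cos (bandX μ θ) * bandVX μ θ ^ 2 + Real.cos (bandY μ θ) * bandVY μ θ ^ 2) := by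
  have hsx := sin_bandX_eq hμ₁ hμ₂ θ
  have hsy := sin_bandY_eq hμ₁ hμ₂ θ
  have key : bandNormalCoeff μ θ ^ 2 * (Real.cos (bandX μ θ) * bandVX μ θ ^ 2 + Real.cos (bandY μ θ) * bandVY μ θ ^ 2) =
      Real.cos (bandX μ θ) * Real.sin (bandY μ θ) ^ 2 + Real.cos (bandY μ θ) * Real.sin (bandX μ θ) ^ 2 := by
    rw [hsx, hsy]; ring
  rw [key]
  have hlevel : sqDispersion ![bandX μ θ, bandY μ θ] = μ := by
    have h := sqDispersion_bandXY hμ₁ hμ₂ θ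
    unfold sqDispersion; simpa using h
  have := level_curvature_numerator_ge_of_sqDispersion_eq hμ₂.le hlevel
  simpa using this

end Convexity

end Literature.MathematicalPhysics.QuantumLattice

end
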